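import Summits.BirchSwinnertonDyer.BirchSwinnertonDyer.Theses.AdditiveKolyvaginRoad
import Summits.BirchSwinnertonDyer.BirchSwinnertonDyer.Theorems.AdditiveKolyvaginRoadManinFrameTransport
import Summits.BirchSwinnertonDyer.BirchSwinnertonDyer.Theorems.AdditiveKolyvaginRoadManinFrameFromDatum
import Summits.BirchSwinnertonDyer.BirchSwinnertonDyer.Theorems.AdditiveKolyvaginRoadManinResidueDegreeOptimal
import Literature.NumberTheory.EllipticCurves.ManinConstantConductorLe300000
import HarnessLib

/-!
# Route `AdditiveKolyvaginRoad`: the crux `ManinFrameResidueProper` (stmt-BirchSwinnertonDyer-20483) IN THE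
# CREMONA RANGE — the first rung of the line `birth` (BC5 witness), modulo Cremona's table by name

The crux asks for a Manin-good odd Heegner frame on the proper Manin residue of the additive road. Its
registered line `birth` (`Cruxes/ManinFrameResidueProper/Lines/birth.lean`) reduces it to "SOME globally
minimal member `W₀ ∼ W` carries a parametrisation datum at level `N(W)` with `p ∤ c`", then transports
(`ManinFrameTransport.exists_modularParametrizationData_not_dvd_of_partner`, Irr) and frames
(`ManinFrameFromDatum.exists_oddHeegnerFrame_of_exists_not_dvd`, Hoffstein–Luo). HERE that member statement
is DISCHARGED for every curve of conductor `≤ 5·10⁵` by Cremona's theorem `c₀ = 1` taken BY NAME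
(`cremona_abs_maninConstant_eq_one_of_level_le_500000`, a hypothesis, never asserted) at the lattice-optimal
datum of the optimal member (`ManinResidueDegreeOptimal.exists_optimal_dvd_iff`, p528365): so the frame —
hence the crux restricted to `N(W) ≤ 5·10⁵` — holds there for EVERY `p ≥ 5` with `E[p]` irreducible and
`r_an = 1`, with no reduction-type, residue or degree hypothesis at all. This is a rung of the crux OUTSIDE the
known regime of the rung statement `WAllExclAdditive` (BSD_p in analytic rank one at an additive prime is not
known at any conductor), exercising exactly the line's lever (member Manin unit ⇒ transport ⇒ frame).
No `sorry`; the Cremona fact and `PublishedInputsAdditiveKoly` (conjuncts 6–7: modularity / newforms and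
Hoffstein–Luo) are hypotheses. (cell `pub/bsd-wall`, tenure planner bsd-wall-add g4 authored the file;
proposed `--supports stmt-BirchSwinnertonDyer-20483` by prover bsd-wall-akr-p2 g5, who re-checked it.)
[cite: AgasheRibetStein2006, Thm. 2.6] [cite: CesnaviciusNeururerSaha2023, §1 p. 2 and ref. [Cre22]]
[cite: HoffsteinLuo1997, Theorem (§1)] [cite: Darmon2004, Thm. 3.6]
-/

set_option autoImplicit false
set_option linter.dupNamespace false

noncomputable section

open scoped Classical

open WeierstrassCurve NumberField Literature.NumberTheory.EllipticCurves
  Literature.NumberTheory.EllipticCurves.ModularForms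
  Literature.NumberTheory.EllipticCurves.Rank1Residual
  Literature.NumberTheory.DiophantineGeometry IsDedekindDomain Rat.HeightOneSpectrum
  Summit.BirchSwinnertonDyer.Rank1Residual Summit.BirchSwinnertonDyer.Rank1Residual.Additive
  Summit.BirchSwinnertonDyer.BirchSwinnertonDyer.Theses.AdditiveKolyvaginRoad

namespace Summit.BirchSwinnertonDyer.BirchSwinnertonDyer.Theorems.ManinFrameResidueProperCremonaRange

/-- **A member with a Manin-unit datum, in the Cremona range (both stubs of the line at once, there).**
For `W/ℚ` globally minimal of conductor `≤ 5·10⁵` and any prime `p`: some globally minimal `W₀ ∼ W` carries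
a parametrisation datum at level `N(W)` with `p ∤ c` — the lattice-optimal datum of the optimal member
(`exists_optimal_dvd_iff`), whose constant is `±1` by Cremona's theorem taken by name
(`not_dvd_maninConstant_of_level_le_500000`).
[cite: AgasheRibetStein2006, Thm. 2.6] [cite: CesnaviciusNeururerSaha2023, §1 p. 2] -/
theorem exists_member_not_dvd_c_of_conductorNorm_le
    (hCre : cremona_abs_maninConstant_eq_one_of_level_le_500000) (hnf : exists_isNewformOf)
    (W : WeierstrassCurve ℚ) [W.IsElliptic] [W.IsGloballyMinimal] [NeZero (W.conductorNorm ℤ)]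
    (hN : W.conductorNorm ℤ ≤ 500000) (p : ℕ) [hp : Fact p.Prime] :
    ∃ (W₀ : WeierstrassCurve ℚ) (_ : W₀.IsElliptic) (_ : W₀.IsGloballyMinimal)
      (D₀ : ModularParametrizationData W₀ (W.conductorNorm ℤ)),
      IsIsogenous W W₀ ∧ ¬ (p : ℤ) ∣ D₀.c := by
  obtain ⟨W₀, hE₀, hM₀, D₀, hiso, hopt, -⟩ :=
    Summit.BirchSwinnertonDyer.BirchSwinnertonDyer.Theorems.ManinResidueDegreeOptimal.exists_optimal_dvd_iff
      hnf p W
  haveI := hE₀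
  haveI := hM₀
  exact ⟨W₀, hE₀, hM₀, D₀, hiso, not_dvd_maninConstant_of_level_le_500000 hCre W₀ D₀ hopt hN hp.out⟩

/-- **The Manin-good odd Heegner frame in the Cremona range.** Modulo Cremona's table by name and
`PublishedInputsAdditiveKoly` (conjuncts 6–7 only): for `W/ℚ` globally minimal of conductor `≤ 5·10⁵`,
`p ≥ 5` with `E[p]` irreducible and `r_an = 1`, the 9-conjunct frame of the road exists — member Manin unit
(above) ⇒ a datum of `W` with `p ∤ c` (partner transport under Irr) ⇒ the Hoffstein–Luo frame.
[cite: AgasheRibetStein2006, Thm. 2.6] [cite: HoffsteinLuo1997, Theorem (§1)] [cite: Darmon2004, Thm. 3.6] -/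
theorem exists_oddHeegnerFrame_of_conductorNorm_le
    (hCre : cremona_abs_maninConstant_eq_one_of_level_le_500000) (hPub : PublishedInputsAdditiveKoly)
    (W : WeierstrassCurve ℚ) [W.IsElliptic] [W.IsGloballyMinimal] (p : ℕ) [hp : Fact p.Prime]
    [NeZero (W.conductorNorm ℤ)] (hN : W.conductorNorm ℤ ≤ 500000) (hp5 : 5 ≤ p) (hirr : Irr W p)
    (hr : W.analyticRank = 1) :
    ∃ (K : Type) (_ : Field K) (_ : NumberField K)
      (Dt : ModularParametrizationData W (W.conductorNorm ℤ))
      (H : HeegnerDatum (W.conductorNorm ℤ) (NumberField.discr K)) (ι : K →+* ℂ)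
      (P : (W.baseChange K).toAffine.Point)
      (Wd : WeierstrassCurve ℚ) (_ : Wd.IsElliptic) (_ : Wd.IsGloballyMinimal) (Cd : VariableChange ℚ),
      IsImaginaryQuadratic K ∧ Odd (NumberField.discr K) ∧ ¬ (p : ℤ) ∣ NumberField.discr K ∧
        SatisfiesHeegnerHypothesis (W.conductorNorm ℤ) K ∧
        WeierstrassCurve.Affine.Point.map ι.toRatAlgHom P = heegnerPointComplex Dt H ∧
        ¬ (p : ℤ) ∣ Dt.c ∧ ¬ p ∣ Units.torsionOrder K ∧
        (W.quadraticTwist (NumberField.discr K : ℚ)).entireLFunction 1 ≠ 0 ∧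
        Cd • W.quadraticTwist (NumberField.discr K : ℚ) = Wd := by
  obtain ⟨W₀, hE₀, hM₀, D₀, hiso, hc₀⟩ :=
    exists_member_not_dvd_c_of_conductorNorm_le hCre hPub.2.2.2.2.2.1 W hN p
  haveI := hE₀
  haveI := hM₀
  obtain ⟨Dt, hc⟩ :=
    Summit.BirchSwinnertonDyer.BirchSwinnertonDyer.Theorems.ManinFrameTransport.exists_modularParametrizationData_not_dvd_of_partner
      W hp.out hirr hiso D₀ hc₀
  have hp2 : p ≠ 2 := by omega
  exact Summit.BirchSwinnertonDyer.BirchSwinnertonDyer.Theorems.ManinFrameFromDatum.exists_oddHeegnerFrame_of_exists_not_dvd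
    hPub.2.2.2.2.2.1 hPub.2.2.2.2.2.2.1 W p hr hp2 ⟨Dt, hc⟩

/-- **The crux `ManinFrameResidueProper` RESTRICTED TO CONDUCTOR `≤ 5·10⁵`, modulo Cremona by name** — its
own statement with the one extra binder `W.conductorNorm ℤ ≤ 500000` (the residue, `Addv` and degree
hypotheses are carried, not used): the first rung of the line `birth`. -/
theorem maninFrameResidueProper_of_conductorNorm_le
    (hCre : cremona_abs_maninConstant_eq_one_of_level_le_500000) :
    PublishedInputsAdditiveKoly → ∀ (W : WeierstrassCurve ℚ) [W.IsElliptic] [W.IsGloballyMinimal]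
      (p : ℕ) [Fact p.Prime] [NeZero (W.conductorNorm ℤ)], W.conductorNorm ℤ ≤ 500000 → 5 ≤ p →
      Addv W p → Irr W p →
      ((p < 11 ∨ ∃ (W' : WeierstrassCurve ℚ) (_ : W'.IsElliptic) (_ : W'.IsGloballyMinimal),
          IsIsogenous W W' ∧ TypeGOrd W' p ∧ padicValInt p W'.minimalDiscriminantInt ≤ 4) ∧
        (∃ (W' : WeierstrassCurve ℚ) (_ : W'.IsElliptic) (_ : W'.IsGloballyMinimal),
          IsIsogenous W W' ∧ ∀ (v : HeightOneSpectrum ℤ) (n : ℕ), natGenerator v = p →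
            W'.kodairaSymbolAt v ≠ KodairaSymbol.Istar n)) →
      (∀ (W' : WeierstrassCurve ℚ) [W'.IsElliptic] [W'.IsGloballyMinimal]
          (D' : ModularParametrizationData W' (W.conductorNorm ℤ)),
          IsIsogenous W W' → p ∣ D'.modularDegree) →
      W.analyticRank = 1 →
      ∃ (K : Type) (_ : Field K) (_ : NumberField K)
        (Dt : ModularParametrizationData W (W.conductorNorm ℤ))
        (H : HeegnerDatum (W.conductorNorm ℤ) (NumberField.discr K)) (ι : K →+* ℂ)
        (P : (W.baseChange K).toAffine.Point)
        (Wd : WeierstrassCurve ℚ) (_ : Wd.IsElliptic) (_ : Wd.IsGloballyMinimal)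
        (Cd : VariableChange ℚ),
        IsImaginaryQuadratic K ∧ Odd (NumberField.discr K) ∧ ¬ (p : ℤ) ∣ NumberField.discr K ∧
          SatisfiesHeegnerHypothesis (W.conductorNorm ℤ) K ∧
          WeierstrassCurve.Affine.Point.map ι.toRatAlgHom P = heegnerPointComplex Dt H ∧
          ¬ (p : ℤ) ∣ Dt.c ∧ ¬ p ∣ Units.torsionOrder K ∧
          (W.quadraticTwist (NumberField.discr K : ℚ)).entireLFunction 1 ≠ 0 ∧
          Cd • W.quadraticTwist (NumberField.discr K : ℚ) = Wd := by
  intro hPub W _ _ p _ _ hN hp5 _hadd hirr _hres _hall hr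
  exact exists_oddHeegnerFrame_of_conductorNorm_le hCre hPub W p hN hp5 hirr hr

end Summit.BirchSwinnertonDyer.BirchSwinnertonDyer.Theorems.ManinFrameResidueProperCremonaRange

end
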